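import Literature.Computability.AlgebraicComplexity.AndrewsForbes2022PfaffianHardnessProofs

/-!
# Andrews–Forbes 2022, Theorem 3.8 / 4.4 in positive characteristic — reductions to Prop. 3.5 / 4.2

The positive-characteristic bullets `AndrewsForbes2022_thm_3_8_posChar` and
`AndrewsForbes2022_thm_4_4_posChar` are typed in `AndrewsForbes2022DeterminantalIdeals.lean`; their
printed proofs (p0024:L40–L45; p0028:L40–L45) are the characteristic-zero proofs with one twist:
writing `t = p^k b`, `p ∤ b`, Frobenius gives `(1 + ĝ)^t = (1 + ĝ^{p^k})^b`, the top gate divides by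
`α b` (a unit) instead of `α t`, and the output is `g^{p^k} + O(ε)`.  The tree's reductions to a single
standard bideterminant / Pfaffian monomial (`AndrewsForbes2022_prop_3_5`, `AndrewsForbes2022_prop_4_2`)
are typed under `[CharZero F]` (the paper states its results over characteristic zero "for
simplicity"; the printed Prop. 3.5, p0021:L41, carries no characteristic hypothesis), so the char-`p`
bullets cannot be discharged from the tree today.  This file proves them FROM the conclusion of
Prop. 3.5 (resp. 4.2) over the field at hand, taken as an explicit hypothesis stated verbatim as in
`BideterminantReduction.lean` without `[CharZero F]` — isolating that as the only missing ingredient —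
by the skeletons of `AndrewsForbes2022_thm_3_8_holds` / `AndrewsForbes2022_thm_4_4_of_prop_4_2` with old
`ε ↦ ε^{D p^k + 1}` (`AndrewsForbes2022_thm_3_8_posChar_at` / `_of`, `AndrewsForbes2022_thm_4_4_posChar_at` /
`_of`; the `_at` forms take the hypothesis for the one field at hand, the `_of` forms yield the typed
facts from it over every field of positive characteristic).  No new named facts
(the hypotheses are inline; D-0026), net debt `0`.

Honest framing: conditional reductions between typed literature statements; VP ≠ VNP is NOT proved.

## References
* [AndrewsForbes2022] R. Andrews, M. A. Forbes, STOC 2022, arXiv:2112.00792 — Prop. 3.5 (p0021),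
  Thm. 3.8 third bullet and its proof (p0023:L57, p0024:L40–L45), Remark 3.11; Prop. 4.2, Thm. 4.4
  second bullet (p0027–p0028).
-/

noncomputable section

open MvPolynomial
open scoped Polynomial RatFunc LaurentSeries Matrix

namespace Literature.Computability.AlgebraicComplexity

set_option maxHeartbeats 1600000 in
open Theorem38 in
/-- **Theorem 3.8, positive-characteristic bullet, from Proposition 3.5 over the given field.**
The tree's `AndrewsForbes2022_prop_3_5` is typed (and proved) under `[CharZero F]`, whereas the
printed Prop. 3.5 (p0021:L41) has no characteristic hypothesis; this theorem isolates that as the ONLY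
obstacle to the char-`p` bullet: from Prop. 3.5's conclusion for fields of characteristic `p` (taken as
the hypothesis `h35F` for the field at hand, stated verbatim as in `BideterminantReduction.lean` without
`[CharZero F]`) the
printed char-`p` argument (p0024:L40–L45) goes through — `t = p^k b` with `p ∤ b`,
`(1 + ĝ)^t = (1 + ĝ^{p^k})^b` (Frobenius), old `ε ↦ ε^{D p^k + 1}`, top gate `÷ α b`, output
`g^{p^k} + O(ε)`; everything else as in `AndrewsForbes2022_thm_3_8_holds`. No new named fact.
[cite: AndrewsForbes2022, Thm. 3.8 (third bullet, proof)] -/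
theorem AndrewsForbes2022_thm_3_8_posChar_at (p : ℕ) [Fact p.Prime] (F : Type) [Field F]
    [CharP F p]
    (h35F : ∀ (n m r : ℕ), 0 < r → r ≤ min n m →
      ∀ f : MvPolynomial (Fin n × Fin m) F, f ∈ detIdeal F n m r → f ≠ 0 →
      ∃ (c : Matrix (Fin n × Fin m) (Fin n × Fin m) (RatFunc F)) (q : ℤ) (α : F) (σ : Multiset ℕ),
        IsUnit c ∧ α ≠ 0 ∧ r ≤ σ.sup ∧ (∀ s ∈ σ, 0 < s ∧ s ≤ min n m) ∧
        ∀ e : (Fin n × Fin m) →₀ ℕ,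
          IsBigOEps F (q + 1) (MvPolynomial.coeff e
            (MvPolynomial.aeval
                (fun ij : Fin n × Fin m =>
                  ∑ kl : Fin n × Fin m, MvPolynomial.C (c ij kl) * MvPolynomial.X kl) f -
              MvPolynomial.C (RatFunc.X ^ q * algebraMap F (RatFunc F) α) *
                MvPolynomial.map (algebraMap F (RatFunc F)) (kBideterminant F n m σ))))
    (n m r : ℕ) (f : MvPolynomial (Fin n × Fin m) F) (hf : f ∈ detIdeal F n m r) (hf0 : f ≠ 0)
    (h : MvPolynomial (Fin n × Fin m) (LaurentSeries F))
    (hh : PolyOrdGE 1 (h - MvPolynomial.map (algebraMap F (LaurentSeries F)) f))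
    (ι : Type) (g : MvPolynomial ι F) (hg : InLayeredABPBorder r g) :
    ∃ e : ℕ, DepthThreeOracleComputes h
      (MvPolynomial.map (algebraMap F (LaurentSeries F)) (g ^ p ^ e)) := by
  classical
  obtain ⟨g', hg'abp, hg'g⟩ := hg
  -- `r = 0`: there is no ABP with `0` vertices
  rcases Nat.eq_zero_or_pos r with hr0 | hr0
  · subst hr0; exact absurd hg'abp (not_layeredABPComputes_zero g')
  -- `r > min(n,m)`: the ideal is `⊥`
  by_cases hrnm : r ≤ n ∧ r ≤ m
  swap
  · exfalso; apply hf0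
    have := hf
    rwa [detIdeal_eq_bot hrnm, Ideal.mem_bot] at this
  obtain ⟨hrn, hrm⟩ := hrnm
  -- Lemma 3.7 and Lemma 3.6
  obtain ⟨ĝ, D, hĝhom, hĝabp, hĝg'⟩ :=
    AndrewsForbes2022_lemma_3_7_holds (Polynomial F) ι r g' hg'abp
  obtain ⟨A, hAdeg, hAdet, hAmin⟩ :=
    AndrewsForbes2022_lemma_3_6_holds (Polynomial F) (Option ι) r ĝ hĝabp
  -- the constant case `D = 0`
  rcases Nat.eq_zero_or_pos D with hD0 | hDpos
  · subst hD0
    have hĝC : ĝ = C (coeff 0 ĝ) := by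
      by_cases hz : ĝ = 0
      · rw [hz]; simp
      · exact totalDegree_eq_zero_iff_eq_C.mp (hĝhom.totalDegree hz)
    have hg'C : g' = C (coeff 0 ĝ) := by
      rw [← hĝg']
      conv_lhs => rw [hĝC]
      rw [aeval_C, MvPolynomial.algebraMap_eq]
    have hgC : g = C ((coeff 0 ĝ).coeff 0) := by
      rw [← hg'g, hg'C, map_C, Polynomial.constantCoeff_apply]
    refine ⟨0, 0, fun _ => 0, 0, algebraMap F (RatFunc F) ((coeff 0 ĝ).coeff 0),
      fun _ => by rw [totalDegree_zero]; exact Nat.zero_le _, ?_⟩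
    rw [pow_zero, pow_one, hgC, map_C, map_zero, C_0, zero_mul, zero_add,
      show algebraMap (RatFunc F) (LaurentSeries F) (algebraMap F (RatFunc F) ((coeff 0 ĝ).coeff 0)) =
        algebraMap F (LaurentSeries F) ((coeff 0 ĝ).coeff 0) from by
          rw [← RingHom.comp_apply, algebraMap_ratFunc_comp_algebraMap], sub_self]
    exact PolyOrdGE.zero 1
  -- Proposition 3.5
  obtain ⟨c, q, α, σ, -, hα, hrσ, hσ, h35⟩ := h35F n m r hr0 (le_min hrn hrm) f hf hf0
  -- the number `t` of parts `≥ r`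
  obtain ⟨t, ht⟩ : ∃ t : ℕ, t = Multiset.card (σ.filter fun s => r ≤ s) := ⟨_, rfl⟩
  have htpos : 0 < t := by
    rw [ht, Multiset.card_pos, Ne, Multiset.filter_eq_nil]
    intro hall
    have : σ.sup ≤ r - 1 := Multiset.sup_le.mpr fun b hb => by
      have := hall b hb; omega
    omega
  -- char `p`: `t = p^k b` with `p ∤ b`, and the Frobenius twist `(1 + ĝ)^t = (1 + ĝ^{p^k})^b`
  obtain ⟨kf, bf, hpb, htkb⟩ :=
    Nat.exists_eq_pow_mul_and_not_dvd htpos.ne' p (Fact.out : p.Prime).ne_one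
  have hbF : (bf : F) ≠ 0 := by
    rw [Ne, CharP.cast_eq_zero_iff F p]; exact hpb
  obtain ⟨E, hE⟩ : ∃ E : ℕ, E = D * p ^ kf := ⟨_, rfl⟩
  have hEpos : 0 < E := by
    rw [hE]; exact Nat.mul_pos hDpos (Nat.pow_pos (Fact.out : p.Prime).pos)
  obtain ⟨ĝ₂, hĝ₂⟩ : ∃ ĝ₂ : MvPolynomial (Option ι) F[X], ĝ₂ = ĝ ^ p ^ kf := ⟨_, rfl⟩
  obtain ⟨g₂', hg₂'⟩ : ∃ g₂' : MvPolynomial ι F[X], g₂' = g' ^ p ^ kf := ⟨_, rfl⟩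
  have hĝ₂hom : ĝ₂.IsHomogeneous E := by rw [hĝ₂, hE]; exact hĝhom.pow _
  have hĝ₂g' : MvPolynomial.aeval (fun o : Option ι => o.elim 1 X) ĝ₂ = g₂' := by
    rw [hĝ₂, hg₂', map_pow, hĝg']
  have hg₂'g : MvPolynomial.map Polynomial.constantCoeff g₂' = g ^ p ^ kf := by
    rw [hg₂', map_pow, hg'g]
  have hfrob : (1 + ĝ) ^ t = (1 + ĝ₂) ^ bf := by
    rw [htkb, pow_mul, add_pow_char_pow, one_pow, hĝ₂]
  -- ring homomorphisms: old `ε ↦ ε^{D+1}`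
  obtain ⟨φL, hφL⟩ : ∃ φL : F[X] →+* LaurentSeries F,
      φL = (epsPow F E).comp (algebraMap F[X] (LaurentSeries F)) := ⟨_, rfl⟩
  obtain ⟨φK, hφK⟩ : ∃ φK : F[X] →+* RatFunc F,
      φK = (algebraMap F[X] (RatFunc F)).comp
        ((Polynomial.expand F (E + 1) : F[X] →ₐ[F] F[X]) : F[X] →+* F[X]) := ⟨_, rfl⟩
  obtain ⟨ψ, hψ⟩ : ∃ ψ : RatFunc F →+* LaurentSeries F,
      ψ = (epsPow F E).comp (algebraMap (RatFunc F) (LaurentSeries F)) := ⟨_, rfl⟩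
  have hKL : (algebraMap (RatFunc F) (LaurentSeries F)).comp φK = φL := by
    refine RingHom.ext fun p => ?_
    rw [hφK, hφL]
    simp only [RingHom.coe_comp, RingHom.coe_coe, Function.comp_apply]
    rw [← IsScalarTower.algebraMap_apply, algebraMap_expand]
  have hψF : ψ.comp (algebraMap F (RatFunc F)) = algebraMap F (LaurentSeries F) := by
    refine RingHom.ext fun a => ?_
    rw [hψ]
    simp only [RingHom.coe_comp, Function.comp_apply]
    rw [show algebraMap (RatFunc F) (LaurentSeries F) (algebraMap F (RatFunc F) a) =
      HahnSeries.C a from coe_ratFunc_algebraMap a, epsPow_C, algebraMap_laurentSeries_apply]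
  -- the matrices `A` over `F(ε)` and `F((ε))` (old `ε` expanded)
  obtain ⟨AK, hAK⟩ : ∃ AK : Matrix (Fin r) (Fin r) (MvPolynomial (Option ι) (RatFunc F)),
      AK = A.map (MvPolynomial.map φK) := ⟨_, rfl⟩
  obtain ⟨AL, hAL⟩ : ∃ AL : Matrix (Fin r) (Fin r) (MvPolynomial (Option ι) (LaurentSeries F)),
      AL = A.map (MvPolynomial.map φL) := ⟨_, rfl⟩
  have hAKL : AK.map (MvPolynomial.map (algebraMap (RatFunc F) (LaurentSeries F))) = AL := by
    rw [hAK, hAL, Matrix.map_map]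
    congr 1
    funext p
    rw [Function.comp_apply, MvPolynomial.map_map, hKL]
  have hALdet : AL.det = 1 + MvPolynomial.map φL ĝ := by
    rw [hAL, ← RingHom.mapMatrix_apply, ← RingHom.map_det, hAdet, map_add, map_one]
  have hALmin : ∀ (k : ℕ) (hk : k < r),
      (AL.submatrix (Fin.castLE hk.le) (Fin.castLE hk.le)).det = 1 := by
    intro k hk
    rw [hAL, Matrix.submatrix_map, ← RingHom.mapMatrix_apply, ← RingHom.map_det, hAmin k hk,
      map_one]
  -- the substitutions
  obtain ⟨θAK, hθAK⟩ : ∃ θ : Fin n × Fin m → MvPolynomial (Option ι) (RatFunc F),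
      θ = fun kl => extMat AK n m kl.1 kl.2 := ⟨_, rfl⟩
  obtain ⟨θAL, hθAL⟩ : ∃ θ : Fin n × Fin m → MvPolynomial (Option ι) (LaurentSeries F),
      θ = fun kl => extMat AL n m kl.1 kl.2 := ⟨_, rfl⟩
  obtain ⟨θεK, hθεK⟩ : ∃ θ : Option ι → MvPolynomial ι (RatFunc F),
      θ = fun o => C RatFunc.X * o.elim 1 X := ⟨_, rfl⟩
  obtain ⟨θεL, hθεL⟩ : ∃ θ : Option ι → MvPolynomial ι (LaurentSeries F),
      θ = fun o => C (HahnSeries.single 1 1) * o.elim 1 X := ⟨_, rfl⟩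
  obtain ⟨ℓK, hℓK⟩ : ∃ ℓ : Fin n × Fin m → MvPolynomial (Fin n × Fin m) (RatFunc F),
      ℓ = fun ij => ∑ kl, C (ratFuncExpand E (c ij kl)) * X kl := ⟨_, rfl⟩
  obtain ⟨ℓL, hℓL⟩ : ∃ ℓ : Fin n × Fin m → MvPolynomial (Fin n × Fin m) (LaurentSeries F),
      ℓ = fun ij => ∑ kl, C (ψ (c ij kl)) * X kl := ⟨_, rfl⟩
  have hθA : ∀ kl, MvPolynomial.map (algebraMap (RatFunc F) (LaurentSeries F)) (θAK kl) = θAL kl := by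
    intro kl
    rw [hθAK, hθAL]
    show MvPolynomial.map _ (extMat AK n m kl.1 kl.2) = extMat AL n m kl.1 kl.2
    rw [← Matrix.map_apply (f := MvPolynomial.map (algebraMap (RatFunc F) (LaurentSeries F)))
      (M := extMat AK n m), extMat_map, hAKL]
  have hθε : ∀ o, MvPolynomial.map (algebraMap (RatFunc F) (LaurentSeries F)) (θεK o) = θεL o := by
    intro o
    rw [hθεK, hθεL]
    cases o <;> simp [map_X]
  have hℓ : ∀ ij, MvPolynomial.map (algebraMap (RatFunc F) (LaurentSeries F)) (ℓK ij) = ℓL ij := by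
    intro ij
    rw [hℓK, hℓL]
    simp only [map_sum, map_mul, map_C, map_X]
    refine Finset.sum_congr rfl fun kl _ => ?_
    rw [show algebraMap (RatFunc F) (LaurentSeries F) (ratFuncExpand E (c ij kl)) = ψ (c ij kl) from
      by rw [hψ]; exact coe_ratFuncExpand E (c ij kl)]
  -- the circuit data
  obtain ⟨a, ha⟩ : ∃ a : Fin n × Fin m → MvPolynomial ι (RatFunc F),
      a = fun ij => MvPolynomial.bind₁ θεK (MvPolynomial.bind₁ θAK (ℓK ij)) := ⟨_, rfl⟩
  obtain ⟨abar, habar⟩ : ∃ abar : Fin n × Fin m → MvPolynomial ι (LaurentSeries F),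
      abar = fun ij => MvPolynomial.bind₁ θεL (MvPolynomial.bind₁ θAL (ℓL ij)) := ⟨_, rfl⟩
  have haL : ∀ ij, MvPolynomial.map (algebraMap (RatFunc F) (LaurentSeries F)) (a ij) = abar ij := by
    intro ij
    rw [ha, habar]
    simp only [map_bind₁, hθε, hθA, hℓ]
  -- orders of the pole of the bottom gates
  obtain ⟨e, he⟩ := IsOrdGE.exists_neg_nat_forall
    (fun p : (Fin n × Fin m) × (Fin n × Fin m) => ((c p.1 p.2 : RatFunc F) : LaurentSeries F))
  have hθAL0 : ∀ kl, PolyOrdGE 0 (θAL kl) := by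
    intro kl
    rw [hθAL]
    refine polyOrdGE_zero_extMat AL (fun i j => ?_) n m kl.1 kl.2
    rw [hAL, Matrix.map_apply, hφL, ← MvPolynomial.map_map]
    simpa using (polyOrdGE_zero_map_polynomial (A i j)).map_epsPow E
  have hθεL0 : ∀ o, PolyOrdGE 0 (θεL o) := by
    intro o
    have h1 : PolyOrdGE 1 (C (HahnSeries.single 1 (1 : F)) : MvPolynomial ι (LaurentSeries F)) :=
      PolyOrdGE.C (IsOrdGE.single 1 1)
    rw [hθεL]
    cases o with
    | none => simpa using h1.mono (by norm_num)
    | some i => simpa using (h1.mul (PolyOrdGE.X i)).mono (by norm_num)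
  have habar_ord : ∀ ij, PolyOrdGE (-(((E + 1) * e : ℕ) : ℤ)) (abar ij) := by
    intro ij
    rw [habar]
    refine PolyOrdGE.bind₁ (PolyOrdGE.bind₁ ?_ hθAL0) hθεL0
    rw [hℓL]
    refine PolyOrdGE.sum fun kl _ => ?_
    have hc : IsOrdGE (((E : ℤ) + 1) * (-(e : ℤ))) (ψ (c ij kl)) := by
      rw [hψ]; exact (he (ij, kl)).epsPow E
    have := (PolyOrdGE.C (σ := Fin n × Fin m) hc).mul (PolyOrdGE.X kl)
    convert this using 1
    push_cast; ring
  -- degrees of the bottom gates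
  have hadeg : ∀ ij, (a ij).totalDegree ≤ 1 := by
    intro ij
    rw [ha]
    refine (totalDegree_bind₁_le_of_le_one θεK (fun o => ?_) _).trans
      ((totalDegree_bind₁_le_of_le_one θAK (fun kl => ?_) _).trans ?_)
    · rw [hθεK]
      cases o with
      | none => simp [totalDegree_C]
      | some i =>
        refine (totalDegree_mul _ _).trans ?_
        simp [totalDegree_C, totalDegree_X]
    · rw [hθAK]
      refine totalDegree_extMat_le AK (fun i j => ?_) n m kl.1 kl.2
      rw [hAK, Matrix.map_apply]
      exact (totalDegree_map_le' _ _).trans (hAdeg i j)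
    · rw [hℓK]; exact totalDegree_linear_le _
  -- the exponents and the top gate
  obtain ⟨Q, hQ⟩ : ∃ Q : ℤ, Q = ((E : ℤ) + 1) * q := ⟨_, rfl⟩
  obtain ⟨fbar, hfbar⟩ : ∃ fbar : MvPolynomial (Fin n × Fin m) (LaurentSeries F),
      fbar = MvPolynomial.map (algebraMap F (LaurentSeries F)) f := ⟨_, rfl⟩
  obtain ⟨gbar, hgbar⟩ : ∃ gbar : MvPolynomial ι (LaurentSeries F),
      gbar = MvPolynomial.map (algebraMap F (LaurentSeries F)) (g ^ p ^ kf) := ⟨_, rfl⟩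
  obtain ⟨Dh, hDh⟩ : ∃ Dh : ℕ, Dh = (h - fbar).totalDegree := ⟨_, rfl⟩
  obtain ⟨N, hN⟩ : ∃ N : ℕ, N = (Q + E).toNat + (E + 1) * e * Dh := ⟨_, rfl⟩
  obtain ⟨u, hu⟩ : ∃ u : RatFunc F,
      u = (RatFunc.X ^ (Q + E) * algebraMap F (RatFunc F) (α * bf))⁻¹ := ⟨_, rfl⟩
  obtain ⟨v, hv⟩ : ∃ v : RatFunc F,
      v = -(RatFunc.X ^ (E : ℤ) * algebraMap F (RatFunc F) (bf : F))⁻¹ := ⟨_, rfl⟩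
  refine ⟨kf, N, a, u, v, hadeg, ?_⟩
  -- images of `u`, `v` in `F((ε))`
  obtain ⟨w, hw⟩ : ∃ w : LaurentSeries F, w = HahnSeries.single (-(E : ℤ)) ((bf : F)⁻¹) := ⟨_, rfl⟩
  have hcoeX : algebraMap (RatFunc F) (LaurentSeries F) RatFunc.X = HahnSeries.single 1 1 :=
    RatFunc.coe_X
  have hubar : algebraMap (RatFunc F) (LaurentSeries F) u =
      HahnSeries.single (-(Q + E)) ((α * bf : F)⁻¹) := by
    rw [hu, map_inv₀, map_mul, map_zpow₀, hcoeX, ← RatFunc.single_zpow,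
      show algebraMap (RatFunc F) (LaurentSeries F) (algebraMap F (RatFunc F) (α * bf)) =
        HahnSeries.C (α * bf) from coe_ratFunc_algebraMap _, HahnSeries.C_apply,
      HahnSeries.single_mul_single, add_zero, one_mul, HahnSeries.inv_single]
  have hvbar : algebraMap (RatFunc F) (LaurentSeries F) v = -w := by
    rw [hv, map_neg, map_inv₀, map_mul, map_zpow₀, hcoeX, ← RatFunc.single_zpow,
      show algebraMap (RatFunc F) (LaurentSeries F) (algebraMap F (RatFunc F) (bf : F)) =
        HahnSeries.C (bf : F) from coe_ratFunc_algebraMap _, HahnSeries.C_apply,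
      HahnSeries.single_mul_single, add_zero, one_mul, HahnSeries.inv_single, hw]
  -- Step 1: the identity of Prop. 3.5, pushed to `F((ε))` with old `ε` expanded
  obtain ⟨ErrK, hErrK⟩ : ∃ ErrK : MvPolynomial (Fin n × Fin m) (RatFunc F),
      ErrK = MvPolynomial.aeval (fun ij : Fin n × Fin m =>
        ∑ kl : Fin n × Fin m, C (c ij kl) * X kl) f -
      C (RatFunc.X ^ q * algebraMap F (RatFunc F) α) *
        MvPolynomial.map (algebraMap F (RatFunc F)) (kBideterminant F n m σ) := ⟨_, rfl⟩
  have hErr : PolyOrdGE (((E : ℤ) + 1) * (q + 1)) (MvPolynomial.map ψ ErrK) := by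
    intro d
    rw [MvPolynomial.coeff_map, hψ, RingHom.comp_apply]
    have := (isBigOEps_iff_isOrdGE _ _).mp (h35 d)
    rw [← hErrK] at this
    exact this.epsPow E
  have hfℓ : MvPolynomial.map ψ (MvPolynomial.aeval (fun ij : Fin n × Fin m =>
      ∑ kl : Fin n × Fin m, C (c ij kl) * X kl) f) = MvPolynomial.bind₁ ℓL fbar := by
    have hfun : (fun i : Fin n × Fin m => MvPolynomial.map ψ
        (∑ kl : Fin n × Fin m, C (c i kl) * (X kl : MvPolynomial _ (RatFunc F)))) = ℓL := by
      rw [hℓL]; funext ij; simp only [map_sum, map_mul, map_C, map_X]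
    rw [← MvPolynomial.aeval_map_algebraMap (RatFunc F), MvPolynomial.aeval_eq_bind₁, map_bind₁,
      MvPolynomial.map_map, hψF, hfbar, hfun]
  have hKσ : MvPolynomial.map ψ (C (RatFunc.X ^ q * algebraMap F (RatFunc F) α) *
      MvPolynomial.map (algebraMap F (RatFunc F)) (kBideterminant F n m σ)) =
      C (HahnSeries.single Q α) * kBideterminant (LaurentSeries F) n m σ := by
    rw [map_mul, map_C, MvPolynomial.map_map, hψF, map_kBideterminant]
    congr 2
    rw [hψ, RingHom.comp_apply, map_mul, map_zpow₀, hcoeX, ← RatFunc.single_zpow,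
      show algebraMap (RatFunc F) (LaurentSeries F) (algebraMap F (RatFunc F) α) =
        HahnSeries.C α from coe_ratFunc_algebraMap _, map_mul, epsPow_single, epsPow_C,
      HahnSeries.C_apply, HahnSeries.single_mul_single, hQ]
    simp
  have hI1 : MvPolynomial.bind₁ ℓL fbar =
      C (HahnSeries.single Q α) * kBideterminant (LaurentSeries F) n m σ +
        MvPolynomial.map ψ ErrK := by
    rw [← hfℓ, ← hKσ, hErrK, map_sub]; ring
  have hfrobL : (1 + MvPolynomial.map φL ĝ) ^ t = (1 + MvPolynomial.map φL ĝ₂) ^ bf := by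
    have := congrArg (MvPolynomial.map φL) hfrob
    simpa only [map_pow, map_add, map_one] using this
  -- Step 2: substitute `X ↦ A ⊕ I`
  have hI2 : MvPolynomial.bind₁ θAL (MvPolynomial.bind₁ ℓL fbar) =
      C (HahnSeries.single Q α) * (1 + MvPolynomial.map φL ĝ₂) ^ bf +
        MvPolynomial.bind₁ θAL (MvPolynomial.map ψ ErrK) := by
    rw [hI1, map_add, map_mul, bind₁_C_right, hθAL, bind₁_kBideterminant_extMat AL hALmin σ hσ,
      hALdet, ← ht, hfrobL]
  have hE2 : PolyOrdGE (((E : ℤ) + 1) * (q + 1))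
      (MvPolynomial.bind₁ θAL (MvPolynomial.map ψ ErrK)) := hErr.bind₁ hθAL0
  -- Step 3: substitute `y ↦ ε y`, `z ↦ ε`
  obtain ⟨G, hG⟩ : ∃ G : MvPolynomial ι (LaurentSeries F), G = MvPolynomial.map φL g₂' := ⟨_, rfl⟩
  have hGeq : MvPolynomial.bind₁ (fun o : Option ι => o.elim 1 X) (MvPolynomial.map φL ĝ₂) = G := by
    have hfun : (fun o : Option ι => MvPolynomial.map φL (o.elim 1 X)) =
        fun o : Option ι => (o.elim 1 X : MvPolynomial ι (LaurentSeries F)) :=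
      funext fun o => by cases o <;> simp [map_X]
    rw [hG, ← hĝ₂g', MvPolynomial.aeval_eq_bind₁, map_bind₁, hfun]
  have hscale : MvPolynomial.bind₁ θεL (MvPolynomial.map φL ĝ₂) =
      C (HahnSeries.single (E : ℤ) (1 : F)) * G := by
    rw [hθεL, bind₁_C_mul_of_isHomogeneous (hĝ₂hom.map φL) (HahnSeries.single 1 1)
      (fun o : Option ι => o.elim 1 X), hGeq, HahnSeries.single_pow]
    simp
  have habar3 : MvPolynomial.bind₁ abar fbar =
      MvPolynomial.bind₁ θεL (MvPolynomial.bind₁ θAL (MvPolynomial.bind₁ ℓL fbar)) := by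
    rw [habar]; simp only [bind₁_bind₁]
  have hI3 : MvPolynomial.bind₁ abar fbar =
      C (HahnSeries.single Q α) * (1 + C (HahnSeries.single (E : ℤ) (1 : F)) * G) ^ bf +
        MvPolynomial.bind₁ θεL (MvPolynomial.bind₁ θAL (MvPolynomial.map ψ ErrK)) := by
    rw [habar3, hI2, map_add, map_mul, bind₁_C_right, map_pow, map_add, map_one, hscale]
  have hE3 : PolyOrdGE (((E : ℤ) + 1) * (q + 1))
      (MvPolynomial.bind₁ θεL (MvPolynomial.bind₁ θAL (MvPolynomial.map ψ ErrK))) :=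
    hE2.bind₁ hθεL0
  -- Step 4: `G = g + O(ε^{D+1})`, `G = O(1)`
  have hG0 : PolyOrdGE 0 G := by
    rw [hG, hφL, ← MvPolynomial.map_map]
    simpa using (polyOrdGE_zero_map_polynomial g₂').map_epsPow E
  have hE4 : PolyOrdGE ((E : ℤ) + 1) (G - gbar) := by
    have h1 := (polyOrdGE_one_map_polynomial_sub g₂').map_epsPow E
    rw [hg₂'g, map_sub, map_epsPow_map_algebraMap, MvPolynomial.map_map, ← hφL, ← hG, ← hgbar,
      mul_one] at h1
    exact h1
  -- Step 5: binomial expansion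
  obtain ⟨W, hW⟩ := add_pow_eq_remainder (C (HahnSeries.single (E : ℤ) (1 : F)) * G) bf
  have hW0 : PolyOrdGE 0 ((W.map (Nat.castRingHom _)).eval
      (C (HahnSeries.single (E : ℤ) (1 : F)) * G)) :=
    polyOrdGE_zero_eval_natPoly W (((PolyOrdGE.C (IsOrdGE.single _ _)).mul hG0).mono (by omega))
  -- Step 6: the `f`-oracle circuit computes `g + O(ε)`
  have hs1 : HahnSeries.single (-(Q + E)) ((α * bf : F)⁻¹) * HahnSeries.single Q α = w := by
    rw [HahnSeries.single_mul_single, hw]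
    congr 1
    · ring
    · field_simp
  have hs3 : w * (bf : LaurentSeries F) * HahnSeries.single (E : ℤ) (1 : F) = 1 := by
    rw [hw, ← map_natCast (HahnSeries.C : F →+* LaurentSeries F) bf, HahnSeries.C_apply,
      HahnSeries.single_mul_single, HahnSeries.single_mul_single, ← HahnSeries.single_zero_one]
    congr 1
    · ring
    · field_simp
  have hmain : PolyOrdGE 1
      (C (algebraMap (RatFunc F) (LaurentSeries F) u) * MvPolynomial.bind₁ abar fbar +
        C (algebraMap (RatFunc F) (LaurentSeries F) v) - gbar) := by
    rw [hubar, hvbar, hI3, hW]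
    have key : C (HahnSeries.single (-(Q + E)) ((α * bf : F)⁻¹)) *
        (C (HahnSeries.single Q α) * (1 + (bf : MvPolynomial ι (LaurentSeries F)) *
          (C (HahnSeries.single (E : ℤ) (1 : F)) * G) +
          (C (HahnSeries.single (E : ℤ) (1 : F)) * G) ^ 2 *
            (W.map (Nat.castRingHom _)).eval (C (HahnSeries.single (E : ℤ) (1 : F)) * G)) +
          MvPolynomial.bind₁ θεL (MvPolynomial.bind₁ θAL (MvPolynomial.map ψ ErrK))) +
        C (-w) - gbar =
      (C (HahnSeries.single (-(Q + E)) ((α * bf : F)⁻¹) * HahnSeries.single Q α) - C w) +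
      ((C (HahnSeries.single (-(Q + E)) ((α * bf : F)⁻¹) * HahnSeries.single Q α *
          (bf : LaurentSeries F) * HahnSeries.single (E : ℤ) (1 : F)) - 1) * gbar +
        C (HahnSeries.single (-(Q + E)) ((α * bf : F)⁻¹) * HahnSeries.single Q α *
          (bf : LaurentSeries F) * HahnSeries.single (E : ℤ) (1 : F)) * (G - gbar)) +
      C (HahnSeries.single (-(Q + E)) ((α * bf : F)⁻¹) * HahnSeries.single Q α *
          HahnSeries.single (E : ℤ) (1 : F) ^ 2) *
        (G ^ 2 * (W.map (Nat.castRingHom _)).eval (C (HahnSeries.single (E : ℤ) (1 : F)) * G)) +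
      C (HahnSeries.single (-(Q + E)) ((α * bf : F)⁻¹)) *
        MvPolynomial.bind₁ θεL (MvPolynomial.bind₁ θAL (MvPolynomial.map ψ ErrK)) := by
      simp only [map_mul, map_neg, map_pow,
        ← map_natCast (C : LaurentSeries F →+* MvPolynomial ι (LaurentSeries F)) bf]
      ring
    rw [key]
    refine ((PolyOrdGE.add ?_ ?_).add ?_).add ?_
    · rw [hs1, sub_self]; exact PolyOrdGE.zero 1
    · rw [hs1, hs3, C_1, sub_self, zero_mul, zero_add, one_mul]
      exact hE4.mono (by omega)
    · have hord : IsOrdGE (E : ℤ) (HahnSeries.single (-(Q + E)) ((α * bf : F)⁻¹) *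
          HahnSeries.single Q α * HahnSeries.single (E : ℤ) (1 : F) ^ 2) := by
        rw [hs1, hw, sq, HahnSeries.single_mul_single, HahnSeries.single_mul_single]
        convert IsOrdGE.single (F := F) _ _ using 2; ring
      have := (PolyOrdGE.C hord).mul ((hG0.pow 2).mul hW0)
      exact this.mono (by simp only [add_zero]; exact_mod_cast hEpos)
    · have hord : IsOrdGE (-(Q + E)) (HahnSeries.single (-(Q + E)) ((α * bf : F)⁻¹)) :=
        IsOrdGE.single _ _
      have := (PolyOrdGE.C hord).mul hE3
      have heq : -(Q + (E : ℤ)) + ((E : ℤ) + 1) * (q + 1) = 1 := by rw [hQ]; ring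
      exact this.mono heq.symm.le
  -- Step 7: replace the `f`-oracle by the `h(·, ε^{N+1})`-oracle
  have hdiff : PolyOrdGE 1 (C (algebraMap (RatFunc F) (LaurentSeries F) u) *
      MvPolynomial.bind₁ abar (MvPolynomial.map (epsPow F N) h - fbar)) := by
    have hsub : MvPolynomial.map (epsPow F N) h - fbar = MvPolynomial.map (epsPow F N) (h - fbar) := by
      rw [map_sub, hfbar, map_epsPow_map_algebraMap]
    have h1 : PolyOrdGE (((N : ℤ) + 1) * 1) (MvPolynomial.map (epsPow F N) (h - fbar)) :=
      (hfbar ▸ hh).map_epsPow N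
    have hdeg : (MvPolynomial.map (epsPow F N) (h - fbar)).totalDegree ≤ Dh := by
      rw [hDh]; exact totalDegree_map_le' _ _
    have h2 := h1.bind₁_of_totalDegree_le hdeg habar_ord
    have hord : IsOrdGE (-(Q + E)) (algebraMap (RatFunc F) (LaurentSeries F) u) := by
      rw [hubar]; exact IsOrdGE.single _ _
    rw [hsub]
    refine ((PolyOrdGE.C hord).mul h2).mono ?_
    have : Q + (E : ℤ) ≤ ((Q + E).toNat : ℤ) := Int.self_le_toNat _
    rw [hN]; push_cast; nlinarith
  -- conclusion
  have hfin := hmain.add hdiff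
  have hfun : (fun x => MvPolynomial.map (algebraMap (RatFunc F) (LaurentSeries F)) (a x)) = abar :=
    funext haL
  rw [MvPolynomial.aeval_eq_bind₁, hfun, ← hgbar]
  have heq : C (algebraMap (RatFunc F) (LaurentSeries F) u) *
        MvPolynomial.bind₁ abar (MvPolynomial.map (epsPow F N) h) +
      C (algebraMap (RatFunc F) (LaurentSeries F) v) - gbar =
      C (algebraMap (RatFunc F) (LaurentSeries F) u) * MvPolynomial.bind₁ abar fbar +
        C (algebraMap (RatFunc F) (LaurentSeries F) v) - gbar +
      C (algebraMap (RatFunc F) (LaurentSeries F) u) *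
        MvPolynomial.bind₁ abar (MvPolynomial.map (epsPow F N) h - fbar) := by
    rw [map_sub]; ring
  rw [heq]
  exact hfin


/-- The char-`p` bullet of Thm. 3.8 as typed (`AndrewsForbes2022_thm_3_8_posChar`), from Prop. 3.5's
conclusion over every field of positive characteristic. [cite: AndrewsForbes2022, Thm. 3.8 (third bullet)] -/
theorem AndrewsForbes2022_thm_3_8_posChar_of
    (h35all : ∀ (p : ℕ) [Fact p.Prime] (F : Type) [Field F] [CharP F p] (n m r : ℕ), 0 < r →
      r ≤ min n m → ∀ f : MvPolynomial (Fin n × Fin m) F, f ∈ detIdeal F n m r → f ≠ 0 →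
      ∃ (c : Matrix (Fin n × Fin m) (Fin n × Fin m) (RatFunc F)) (q : ℤ) (α : F) (σ : Multiset ℕ),
        IsUnit c ∧ α ≠ 0 ∧ r ≤ σ.sup ∧ (∀ s ∈ σ, 0 < s ∧ s ≤ min n m) ∧
        ∀ e : (Fin n × Fin m) →₀ ℕ,
          IsBigOEps F (q + 1) (MvPolynomial.coeff e
            (MvPolynomial.aeval
                (fun ij : Fin n × Fin m =>
                  ∑ kl : Fin n × Fin m, MvPolynomial.C (c ij kl) * MvPolynomial.X kl) f -
              MvPolynomial.C (RatFunc.X ^ q * algebraMap F (RatFunc F) α) *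
                MvPolynomial.map (algebraMap F (RatFunc F)) (kBideterminant F n m σ)))) :
    AndrewsForbes2022_thm_3_8_posChar :=
  fun p _ F _ _ n m r f hf hf0 h hh ι g hg =>
    AndrewsForbes2022_thm_3_8_posChar_at p F (fun n m r => h35all p F n m r) n m r f hf hf0 h hh ι g hg

/-! #### Theorem 4.4, positive characteristic -/

set_option maxHeartbeats 1600000 in
open Theorem38 Lemma43 Theorem44 in
/-- **Theorem 4.4, positive-characteristic bullet, from Proposition 4.2 over the given field**
(hypothesis `h42F` = the body of `AndrewsForbes2022_prop_4_2` without `[CharZero F]`, for the field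
at hand): the printed
char-`p` argument (p0028:L40–L45) — `t = p^k b`, `p ∤ b`, `(1 + ĝ)^t = (1 + ĝ^{p^k})^b`, old
`ε ↦ ε^{D p^k + 1}`, top gate `÷ α b`, output `g^{p^k} + O(ε)` — on the skeleton of
`AndrewsForbes2022_thm_4_4_of_prop_4_2`. No new named fact.
[cite: AndrewsForbes2022, Thm. 4.4 (second bullet, proof)] -/
theorem AndrewsForbes2022_thm_4_4_posChar_at (p : ℕ) [Fact p.Prime] (F : Type) [Field F]
    [CharP F p]
    (h42F : ∀ (n r : ℕ), 0 < r → r ≤ n →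
      ∀ f : MvPolynomial (SkewVarIdx (2 * n)) F, f ∈ pfaffIdeal F n r → f ≠ 0 →
      ∃ (P : Matrix (Fin (2 * n)) (Fin (2 * n)) (RatFunc F)) (q : ℤ) (α : F) (σ : Multiset ℕ),
        IsUnit P ∧ α ≠ 0 ∧ 2 * r ≤ σ.sup ∧ (∀ s ∈ σ, Even s ∧ 0 < s ∧ s ≤ 2 * n) ∧
        ∀ e : SkewVarIdx (2 * n) →₀ ℕ,
          IsBigOEps F (q + 1) (MvPolynomial.coeff e
            (skewCongr P f -
              MvPolynomial.C (RatFunc.X ^ q * algebraMap F (RatFunc F) α) *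
                MvPolynomial.map (algebraMap F (RatFunc F)) (kPfaffMonomial F (2 * n) σ))))
    (n r : ℕ) (f : MvPolynomial (SkewVarIdx (2 * n)) F) (hf : f ∈ pfaffIdeal F n r) (hf0 : f ≠ 0)
    (h : MvPolynomial (SkewVarIdx (2 * n)) (LaurentSeries F))
    (hh : PolyOrdGE 1 (h - MvPolynomial.map (algebraMap F (LaurentSeries F)) f))
    (ι : Type) (g : MvPolynomial ι F) (hg : InLayeredABPBorder r g) :
    ∃ e : ℕ, DepthThreeOracleComputes h
      (MvPolynomial.map (algebraMap F (LaurentSeries F)) (g ^ p ^ e)) := by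
  classical
  obtain ⟨g', hg'abp, hg'g⟩ := hg
  rcases Nat.eq_zero_or_pos r with hr0 | hr0
  · subst hr0; exact absurd hg'abp (not_layeredABPComputes_zero g')
  by_cases hrn : r ≤ n
  swap
  · exfalso; apply hf0
    have := hf
    rwa [pfaffIdeal_eq_bot (Nat.lt_of_not_le hrn), Ideal.mem_bot] at this
  obtain ⟨ĝ, D, hĝhom, hĝabp, hĝg'⟩ :=
    AndrewsForbes2022_lemma_3_7_holds (Polynomial F) ι r g' hg'abp
  obtain ⟨A, hAdeg, hAdet, hAmin⟩ :=
    AndrewsForbes2022_lemma_3_6_holds (Polynomial F) (Option ι) r ĝ hĝabp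
  -- the constant case `D = 0`
  rcases Nat.eq_zero_or_pos D with hD0 | hDpos
  · subst hD0
    have hĝC : ĝ = C (coeff 0 ĝ) := by
      by_cases hz : ĝ = 0
      · rw [hz]; simp
      · exact totalDegree_eq_zero_iff_eq_C.mp (hĝhom.totalDegree hz)
    have hg'C : g' = C (coeff 0 ĝ) := by
      rw [← hĝg']
      conv_lhs => rw [hĝC]
      rw [aeval_C, MvPolynomial.algebraMap_eq]
    have hgC : g = C ((coeff 0 ĝ).coeff 0) := by
      rw [← hg'g, hg'C, map_C, Polynomial.constantCoeff_apply]
    refine ⟨0, 0, fun _ => 0, 0, algebraMap F (RatFunc F) ((coeff 0 ĝ).coeff 0),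
      fun _ => by rw [totalDegree_zero]; exact Nat.zero_le _, ?_⟩
    rw [pow_zero, pow_one, hgC, map_C, map_zero, C_0, zero_mul, zero_add,
      show algebraMap (RatFunc F) (LaurentSeries F) (algebraMap F (RatFunc F) ((coeff 0 ĝ).coeff 0)) =
        algebraMap F (LaurentSeries F) ((coeff 0 ĝ).coeff 0) from by
          rw [← RingHom.comp_apply, algebraMap_ratFunc_comp_algebraMap], sub_self]
    exact PolyOrdGE.zero 1
  -- Proposition 4.2
  obtain ⟨P, q, α, σ, -, hα, hrσ, hσ, h35⟩ := h42F n r hr0 hrn f hf hf0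
  obtain ⟨t, ht⟩ : ∃ t : ℕ, t = Multiset.card (σ.filter fun s => 2 * r ≤ s) := ⟨_, rfl⟩
  have htpos : 0 < t := by
    rw [ht, Multiset.card_pos, Ne, Multiset.filter_eq_nil]
    intro hall
    have : σ.sup ≤ 2 * r - 1 := Multiset.sup_le.mpr fun b hb => by
      have := hall b hb; omega
    omega
  -- char `p`: `t = p^k b` with `p ∤ b`, and the Frobenius twist `(1 + ĝ)^t = (1 + ĝ^{p^k})^b`
  obtain ⟨kf, bf, hpb, htkb⟩ :=
    Nat.exists_eq_pow_mul_and_not_dvd htpos.ne' p (Fact.out : p.Prime).ne_one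
  have hbF : (bf : F) ≠ 0 := by
    rw [Ne, CharP.cast_eq_zero_iff F p]; exact hpb
  obtain ⟨E, hE⟩ : ∃ E : ℕ, E = D * p ^ kf := ⟨_, rfl⟩
  have hEpos : 0 < E := by
    rw [hE]; exact Nat.mul_pos hDpos (Nat.pow_pos (Fact.out : p.Prime).pos)
  obtain ⟨ĝ₂, hĝ₂⟩ : ∃ ĝ₂ : MvPolynomial (Option ι) F[X], ĝ₂ = ĝ ^ p ^ kf := ⟨_, rfl⟩
  obtain ⟨g₂', hg₂'⟩ : ∃ g₂' : MvPolynomial ι F[X], g₂' = g' ^ p ^ kf := ⟨_, rfl⟩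
  have hĝ₂hom : ĝ₂.IsHomogeneous E := by rw [hĝ₂, hE]; exact hĝhom.pow _
  have hĝ₂g' : MvPolynomial.aeval (fun o : Option ι => o.elim 1 X) ĝ₂ = g₂' := by
    rw [hĝ₂, hg₂', map_pow, hĝg']
  have hg₂'g : MvPolynomial.map Polynomial.constantCoeff g₂' = g ^ p ^ kf := by
    rw [hg₂', map_pow, hg'g]
  have hfrob : (1 + ĝ) ^ t = (1 + ĝ₂) ^ bf := by
    rw [htkb, pow_mul, add_pow_char_pow, one_pow, hĝ₂]
  -- ring homomorphisms: old `ε ↦ ε^{D+1}`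
  obtain ⟨φL, hφL⟩ : ∃ φL : F[X] →+* LaurentSeries F,
      φL = (epsPow F E).comp (algebraMap F[X] (LaurentSeries F)) := ⟨_, rfl⟩
  obtain ⟨φK, hφK⟩ : ∃ φK : F[X] →+* RatFunc F,
      φK = (algebraMap F[X] (RatFunc F)).comp
        ((Polynomial.expand F (E + 1) : F[X] →ₐ[F] F[X]) : F[X] →+* F[X]) := ⟨_, rfl⟩
  obtain ⟨ψ, hψ⟩ : ∃ ψ : RatFunc F →+* LaurentSeries F,
      ψ = (epsPow F E).comp (algebraMap (RatFunc F) (LaurentSeries F)) := ⟨_, rfl⟩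
  have hKL : (algebraMap (RatFunc F) (LaurentSeries F)).comp φK = φL := by
    refine RingHom.ext fun p => ?_
    rw [hφK, hφL]
    simp only [RingHom.coe_comp, RingHom.coe_coe, Function.comp_apply]
    rw [← IsScalarTower.algebraMap_apply, algebraMap_expand]
  have hψF : ψ.comp (algebraMap F (RatFunc F)) = algebraMap F (LaurentSeries F) := by
    refine RingHom.ext fun a => ?_
    rw [hψ]
    simp only [RingHom.coe_comp, Function.comp_apply]
    rw [show algebraMap (RatFunc F) (LaurentSeries F) (algebraMap F (RatFunc F) a) =
      HahnSeries.C a from coe_ratFunc_algebraMap a, epsPow_C, algebraMap_laurentSeries_apply]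
  have hψexp : ∀ x : RatFunc F, algebraMap (RatFunc F) (LaurentSeries F) (ratFuncExpand E x) = ψ x := by
    intro x; rw [hψ]; exact coe_ratFuncExpand E x
  -- the matrices `A`, `M` over `F(ε)` and `F((ε))` (old `ε` expanded)
  obtain ⟨AK, hAK⟩ : ∃ AK : Matrix (Fin r) (Fin r) (MvPolynomial (Option ι) (RatFunc F)),
      AK = A.map (MvPolynomial.map φK) := ⟨_, rfl⟩
  obtain ⟨AL, hAL⟩ : ∃ AL : Matrix (Fin r) (Fin r) (MvPolynomial (Option ι) (LaurentSeries F)),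
      AL = A.map (MvPolynomial.map φL) := ⟨_, rfl⟩
  have hAKL : AK.map (MvPolynomial.map (algebraMap (RatFunc F) (LaurentSeries F))) = AL := by
    rw [hAK, hAL, Matrix.map_map]
    congr 1
    funext p
    rw [Function.comp_apply, MvPolynomial.map_map, hKL]
  have hALdet : AL.det = 1 + MvPolynomial.map φL ĝ := by
    rw [hAL, ← RingHom.mapMatrix_apply, ← RingHom.map_det, hAdet, map_add, map_one]
  have hALmin : ∀ (k : ℕ) (hk : k < r),
      (AL.submatrix (Fin.castLE hk.le) (Fin.castLE hk.le)).det = 1 := by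
    intro k hk
    rw [hAL, Matrix.submatrix_map, ← RingHom.mapMatrix_apply, ← RingHom.map_det, hAmin k hk,
      map_one]
  obtain ⟨MK, hMK⟩ : ∃ MK : Matrix (Fin (2 * n)) (Fin (2 * n)) (MvPolynomial (Option ι) (RatFunc F)),
      MK = ilM (extMat AK n n) := ⟨_, rfl⟩
  obtain ⟨ML, hML⟩ : ∃ ML : Matrix (Fin (2 * n)) (Fin (2 * n)) (MvPolynomial (Option ι) (LaurentSeries F)),
      ML = ilM (extMat AL n n) := ⟨_, rfl⟩
  have hMKL : MK.map (MvPolynomial.map (algebraMap (RatFunc F) (LaurentSeries F))) = ML := by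
    rw [hMK, hML, ilM_map, extMat_map, hAKL]
  -- the substitutions
  obtain ⟨θMK, hθMK⟩ : ∃ θ : SkewVarIdx (2 * n) → MvPolynomial (Option ι) (RatFunc F),
      θ = fun p => MK p.1.1 p.1.2 := ⟨_, rfl⟩
  obtain ⟨θML, hθML⟩ : ∃ θ : SkewVarIdx (2 * n) → MvPolynomial (Option ι) (LaurentSeries F),
      θ = fun p => ML p.1.1 p.1.2 := ⟨_, rfl⟩
  obtain ⟨θεK, hθεK⟩ : ∃ θ : Option ι → MvPolynomial ι (RatFunc F),
      θ = fun o => C RatFunc.X * o.elim 1 X := ⟨_, rfl⟩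
  obtain ⟨θεL, hθεL⟩ : ∃ θ : Option ι → MvPolynomial ι (LaurentSeries F),
      θ = fun o => C (HahnSeries.single 1 1) * o.elim 1 X := ⟨_, rfl⟩
  obtain ⟨PK, hPK⟩ : ∃ PK : Matrix (Fin (2 * n)) (Fin (2 * n)) (RatFunc F),
      PK = P.map (ratFuncExpand E) := ⟨_, rfl⟩
  obtain ⟨PL, hPL⟩ : ∃ PL : Matrix (Fin (2 * n)) (Fin (2 * n)) (LaurentSeries F),
      PL = P.map ψ := ⟨_, rfl⟩
  obtain ⟨NK, hNK⟩ : ∃ NK : Matrix (Fin (2 * n)) (Fin (2 * n)) (MvPolynomial (SkewVarIdx (2 * n)) (RatFunc F)),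
      NK = PK.map C * skewX (RatFunc F) (2 * n) * (PK.map C)ᵀ := ⟨_, rfl⟩
  obtain ⟨NL, hNL⟩ : ∃ NL : Matrix (Fin (2 * n)) (Fin (2 * n)) (MvPolynomial (SkewVarIdx (2 * n)) (LaurentSeries F)),
      NL = PL.map C * skewX (LaurentSeries F) (2 * n) * (PL.map C)ᵀ := ⟨_, rfl⟩
  have hsk : ∀ a b, MvPolynomial.map (algebraMap (RatFunc F) (LaurentSeries F))
      (skewX (RatFunc F) (2 * n) a b) = skewX (LaurentSeries F) (2 * n) a b := fun a b => by
    rw [← Matrix.map_apply (f := MvPolynomial.map (algebraMap (RatFunc F) (LaurentSeries F)))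
      (M := skewX (RatFunc F) (2 * n)), skewX_map]
  have hskψ : ∀ a b, MvPolynomial.map ψ (skewX (RatFunc F) (2 * n) a b) =
      skewX (LaurentSeries F) (2 * n) a b := fun a b => by
    rw [← Matrix.map_apply (f := MvPolynomial.map ψ) (M := skewX (RatFunc F) (2 * n)), skewX_map]
  have hNKL : NK.map (MvPolynomial.map (algebraMap (RatFunc F) (LaurentSeries F))) = NL := by
    ext i j
    rw [Matrix.map_apply, hNK, hNL, hPK, hPL]
    simp only [Matrix.mul_apply, Matrix.transpose_apply, Matrix.map_apply, map_sum, map_mul, map_C,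
      hψexp, hsk]
  have hN0 : (P.map (C : RatFunc F →+* MvPolynomial (SkewVarIdx (2 * n)) (RatFunc F)) *
      skewX (RatFunc F) (2 * n) * (P.map C)ᵀ).map (MvPolynomial.map ψ) = NL := by
    ext i j
    rw [Matrix.map_apply, hNL, hPL]
    simp only [Matrix.mul_apply, Matrix.transpose_apply, Matrix.map_apply, map_sum, map_mul, map_C,
      hskψ]
  obtain ⟨ℓK, hℓK⟩ : ∃ ℓ : SkewVarIdx (2 * n) → MvPolynomial (SkewVarIdx (2 * n)) (RatFunc F),
      ℓ = fun ij => NK ij.1.1 ij.1.2 := ⟨_, rfl⟩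
  obtain ⟨ℓL, hℓL⟩ : ∃ ℓ : SkewVarIdx (2 * n) → MvPolynomial (SkewVarIdx (2 * n)) (LaurentSeries F),
      ℓ = fun ij => NL ij.1.1 ij.1.2 := ⟨_, rfl⟩
  have hθM : ∀ kl, MvPolynomial.map (algebraMap (RatFunc F) (LaurentSeries F)) (θMK kl) = θML kl := by
    intro kl
    rw [hθMK, hθML]
    show MvPolynomial.map _ (MK kl.1.1 kl.1.2) = ML kl.1.1 kl.1.2
    rw [← Matrix.map_apply (f := MvPolynomial.map (algebraMap (RatFunc F) (LaurentSeries F)))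
      (M := MK), hMKL]
  have hθε : ∀ o, MvPolynomial.map (algebraMap (RatFunc F) (LaurentSeries F)) (θεK o) = θεL o := by
    intro o
    rw [hθεK, hθεL]
    cases o <;> simp [map_X]
  have hℓ : ∀ ij, MvPolynomial.map (algebraMap (RatFunc F) (LaurentSeries F)) (ℓK ij) = ℓL ij := by
    intro ij
    rw [hℓK, hℓL]
    show MvPolynomial.map _ (NK ij.1.1 ij.1.2) = NL ij.1.1 ij.1.2
    rw [← Matrix.map_apply (f := MvPolynomial.map (algebraMap (RatFunc F) (LaurentSeries F)))
      (M := NK), hNKL]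
  -- the circuit data
  obtain ⟨a, ha⟩ : ∃ a : SkewVarIdx (2 * n) → MvPolynomial ι (RatFunc F),
      a = fun ij => MvPolynomial.bind₁ θεK (MvPolynomial.bind₁ θMK (ℓK ij)) := ⟨_, rfl⟩
  obtain ⟨abar, habar⟩ : ∃ abar : SkewVarIdx (2 * n) → MvPolynomial ι (LaurentSeries F),
      abar = fun ij => MvPolynomial.bind₁ θεL (MvPolynomial.bind₁ θML (ℓL ij)) := ⟨_, rfl⟩
  have haL : ∀ ij, MvPolynomial.map (algebraMap (RatFunc F) (LaurentSeries F)) (a ij) = abar ij := by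
    intro ij
    rw [ha, habar]
    simp only [map_bind₁, hθε, hθM, hℓ]
  -- orders of the pole of the bottom gates
  obtain ⟨e, he⟩ := IsOrdGE.exists_neg_nat_forall
    (fun p : Fin (2 * n) × Fin (2 * n) => ((P p.1 p.2 : RatFunc F) : LaurentSeries F))
  have hAL0 : ∀ i j, PolyOrdGE 0 (AL i j) := by
    intro i j
    rw [hAL, Matrix.map_apply, hφL, ← MvPolynomial.map_map]
    simpa using (polyOrdGE_zero_map_polynomial (A i j)).map_epsPow E
  have hθML0 : ∀ kl, PolyOrdGE 0 (θML kl) := by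
    intro kl
    rw [hθML]
    show PolyOrdGE 0 (ML kl.1.1 kl.1.2)
    rw [hML]
    exact polyOrdGE_zero_ilM _ (fun a b => polyOrdGE_zero_extMat AL hAL0 n n a b) _ _
  have hθεL0 : ∀ o, PolyOrdGE 0 (θεL o) := by
    intro o
    have h1 : PolyOrdGE 1 (C (HahnSeries.single 1 (1 : F)) : MvPolynomial ι (LaurentSeries F)) :=
      PolyOrdGE.C (IsOrdGE.single 1 1)
    rw [hθεL]
    cases o with
    | none => simpa using h1.mono (by norm_num)
    | some i => simpa using (h1.mul (PolyOrdGE.X i)).mono (by norm_num)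
  have hPL : ∀ i j, IsOrdGE (-(((E + 1) * e : ℕ) : ℤ)) (PL i j) := by
    intro i j
    rw [hPL, Matrix.map_apply, hψ, RingHom.comp_apply]
    have := (he (i, j)).epsPow E
    convert this using 1
    push_cast; ring
  have habar_ord : ∀ ij, PolyOrdGE (-((2 * ((E + 1) * e) : ℕ) : ℤ)) (abar ij) := by
    intro ij
    rw [habar]
    refine PolyOrdGE.bind₁ (PolyOrdGE.bind₁ ?_ hθML0) hθεL0
    rw [hℓL]
    show PolyOrdGE _ (NL ij.1.1 ij.1.2)
    rw [hNL]
    exact polyOrdGE_conj PL hPL _ (polyOrdGE_zero_skewX (2 * n)) _ _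
  -- degrees of the bottom gates
  have hadeg : ∀ ij, (a ij).totalDegree ≤ 1 := by
    intro ij
    rw [ha]
    refine (totalDegree_bind₁_le_of_le_one θεK (fun o => ?_) _).trans
      ((totalDegree_bind₁_le_of_le_one θMK (fun kl => ?_) _).trans ?_)
    · rw [hθεK]
      cases o with
      | none => simp [totalDegree_C]
      | some i =>
        refine (totalDegree_mul _ _).trans ?_
        simp [totalDegree_C, totalDegree_X]
    · rw [hθMK]
      show (MK kl.1.1 kl.1.2).totalDegree ≤ 1
      rw [hMK]
      refine totalDegree_ilM_le _ (fun a' b' => totalDegree_extMat_le AK (fun i j => ?_) n n a' b') _ _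
      rw [hAK, Matrix.map_apply]
      exact (totalDegree_map_le' _ _).trans (hAdeg i j)
    · rw [hℓK]
      show (NK ij.1.1 ij.1.2).totalDegree ≤ 1
      rw [hNK]
      exact totalDegree_conj_le PK _ (totalDegree_skewX_le (2 * n)) _ _
  -- the exponents and the top gate
  obtain ⟨Q, hQ⟩ : ∃ Q : ℤ, Q = ((E : ℤ) + 1) * q := ⟨_, rfl⟩
  obtain ⟨fbar, hfbar⟩ : ∃ fbar : MvPolynomial (SkewVarIdx (2 * n)) (LaurentSeries F),
      fbar = MvPolynomial.map (algebraMap F (LaurentSeries F)) f := ⟨_, rfl⟩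
  obtain ⟨gbar, hgbar⟩ : ∃ gbar : MvPolynomial ι (LaurentSeries F),
      gbar = MvPolynomial.map (algebraMap F (LaurentSeries F)) (g ^ p ^ kf) := ⟨_, rfl⟩
  obtain ⟨Dh, hDh⟩ : ∃ Dh : ℕ, Dh = (h - fbar).totalDegree := ⟨_, rfl⟩
  obtain ⟨N, hN⟩ : ∃ N : ℕ, N = (Q + E).toNat + (2 * ((E + 1) * e)) * Dh := ⟨_, rfl⟩
  obtain ⟨u, hu⟩ : ∃ u : RatFunc F,
      u = (RatFunc.X ^ (Q + E) * algebraMap F (RatFunc F) (α * bf))⁻¹ := ⟨_, rfl⟩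
  obtain ⟨v, hv⟩ : ∃ v : RatFunc F,
      v = -(RatFunc.X ^ (E : ℤ) * algebraMap F (RatFunc F) (bf : F))⁻¹ := ⟨_, rfl⟩
  refine ⟨kf, N, a, u, v, hadeg, ?_⟩
  obtain ⟨w, hw⟩ : ∃ w : LaurentSeries F, w = HahnSeries.single (-(E : ℤ)) ((bf : F)⁻¹) := ⟨_, rfl⟩
  have hcoeX : algebraMap (RatFunc F) (LaurentSeries F) RatFunc.X = HahnSeries.single 1 1 :=
    RatFunc.coe_X
  have hubar : algebraMap (RatFunc F) (LaurentSeries F) u =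
      HahnSeries.single (-(Q + E)) ((α * bf : F)⁻¹) := by
    rw [hu, map_inv₀, map_mul, map_zpow₀, hcoeX, ← RatFunc.single_zpow,
      show algebraMap (RatFunc F) (LaurentSeries F) (algebraMap F (RatFunc F) (α * bf)) =
        HahnSeries.C (α * bf) from coe_ratFunc_algebraMap _, HahnSeries.C_apply,
      HahnSeries.single_mul_single, add_zero, one_mul, HahnSeries.inv_single]
  have hvbar : algebraMap (RatFunc F) (LaurentSeries F) v = -w := by
    rw [hv, map_neg, map_inv₀, map_mul, map_zpow₀, hcoeX, ← RatFunc.single_zpow,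
      show algebraMap (RatFunc F) (LaurentSeries F) (algebraMap F (RatFunc F) (bf : F)) =
        HahnSeries.C (bf : F) from coe_ratFunc_algebraMap _, HahnSeries.C_apply,
      HahnSeries.single_mul_single, add_zero, one_mul, HahnSeries.inv_single, hw]
  -- Step 1: the identity of Prop. 4.2, pushed to `F((ε))` with old `ε` expanded
  obtain ⟨ErrK, hErrK⟩ : ∃ ErrK : MvPolynomial (SkewVarIdx (2 * n)) (RatFunc F),
      ErrK = skewCongr P f -
      C (RatFunc.X ^ q * algebraMap F (RatFunc F) α) *
        MvPolynomial.map (algebraMap F (RatFunc F)) (kPfaffMonomial F (2 * n) σ) := ⟨_, rfl⟩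
  have hErr : PolyOrdGE (((E : ℤ) + 1) * (q + 1)) (MvPolynomial.map ψ ErrK) := by
    intro d
    rw [MvPolynomial.coeff_map, hψ, RingHom.comp_apply]
    have := (isBigOEps_iff_isOrdGE _ _).mp (h35 d)
    rw [← hErrK] at this
    exact this.epsPow E
  have hfℓ : MvPolynomial.map ψ (skewCongr P f) = MvPolynomial.bind₁ ℓL fbar := by
    have hentry : ∀ ij : SkewVarIdx (2 * n), MvPolynomial.map ψ
        (((P.map (C : RatFunc F →+* MvPolynomial (SkewVarIdx (2 * n)) (RatFunc F))) *
          skewX (RatFunc F) (2 * n) *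
          (P.map (C : RatFunc F →+* MvPolynomial (SkewVarIdx (2 * n)) (RatFunc F)))ᵀ :
            Matrix (Fin (2 * n)) (Fin (2 * n)) (MvPolynomial (SkewVarIdx (2 * n)) (RatFunc F)))
          ij.1.1 ij.1.2) = ℓL ij := by
      intro ij
      rw [hℓL, ← Matrix.map_apply (f := MvPolynomial.map ψ), hN0]
    rw [skewCongr, ← MvPolynomial.aeval_map_algebraMap (RatFunc F), MvPolynomial.aeval_eq_bind₁,
      map_bind₁, MvPolynomial.map_map, hψF, hfbar]
    simp only [hentry]
  have hKσ : MvPolynomial.map ψ (C (RatFunc.X ^ q * algebraMap F (RatFunc F) α) *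
      MvPolynomial.map (algebraMap F (RatFunc F)) (kPfaffMonomial F (2 * n) σ)) =
      C (HahnSeries.single Q α) * kPfaffMonomial (LaurentSeries F) (2 * n) σ := by
    rw [map_mul, map_C, MvPolynomial.map_map, hψF, map_kPfaffMonomial]
    congr 2
    rw [hψ, RingHom.comp_apply, map_mul, map_zpow₀, hcoeX, ← RatFunc.single_zpow,
      show algebraMap (RatFunc F) (LaurentSeries F) (algebraMap F (RatFunc F) α) =
        HahnSeries.C α from coe_ratFunc_algebraMap _, map_mul, epsPow_single, epsPow_C,
      HahnSeries.C_apply, HahnSeries.single_mul_single, hQ]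
    simp
  have hI1 : MvPolynomial.bind₁ ℓL fbar =
      C (HahnSeries.single Q α) * kPfaffMonomial (LaurentSeries F) (2 * n) σ +
        MvPolynomial.map ψ ErrK := by
    rw [← hfℓ, ← hKσ, hErrK, map_sub]; ring
  have hfrobL : (1 + MvPolynomial.map φL ĝ) ^ t = (1 + MvPolynomial.map φL ĝ₂) ^ bf := by
    have := congrArg (MvPolynomial.map φL) hfrob
    simpa only [map_pow, map_add, map_one] using this
  -- Step 2: substitute `X ↦ M`
  have hI2 : MvPolynomial.bind₁ θML (MvPolynomial.bind₁ ℓL fbar) =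
      C (HahnSeries.single Q α) * (1 + MvPolynomial.map φL ĝ₂) ^ bf +
        MvPolynomial.bind₁ θML (MvPolynomial.map ψ ErrK) := by
    rw [hI1, map_add, map_mul, bind₁_C_right, hθML, hML,
      bind₁_kPfaffMonomial_ilM_extMat AL hALmin σ hσ, hALdet, ← ht, hfrobL]
  have hE2 : PolyOrdGE (((E : ℤ) + 1) * (q + 1))
      (MvPolynomial.bind₁ θML (MvPolynomial.map ψ ErrK)) := hErr.bind₁ hθML0
  -- Step 3: substitute `y ↦ ε y`, `z ↦ ε`
  obtain ⟨G, hG⟩ : ∃ G : MvPolynomial ι (LaurentSeries F), G = MvPolynomial.map φL g₂' := ⟨_, rfl⟩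
  have hGeq : MvPolynomial.bind₁ (fun o : Option ι => o.elim 1 X) (MvPolynomial.map φL ĝ₂) = G := by
    have hfun : (fun o : Option ι => MvPolynomial.map φL (o.elim 1 X)) =
        fun o : Option ι => (o.elim 1 X : MvPolynomial ι (LaurentSeries F)) :=
      funext fun o => by cases o <;> simp [map_X]
    rw [hG, ← hĝ₂g', MvPolynomial.aeval_eq_bind₁, map_bind₁, hfun]
  have hscale : MvPolynomial.bind₁ θεL (MvPolynomial.map φL ĝ₂) =
      C (HahnSeries.single (E : ℤ) (1 : F)) * G := by
    rw [hθεL, bind₁_C_mul_of_isHomogeneous (hĝ₂hom.map φL) (HahnSeries.single 1 1)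
      (fun o : Option ι => o.elim 1 X), hGeq, HahnSeries.single_pow]
    simp
  have habar3 : MvPolynomial.bind₁ abar fbar =
      MvPolynomial.bind₁ θεL (MvPolynomial.bind₁ θML (MvPolynomial.bind₁ ℓL fbar)) := by
    rw [habar]; simp only [bind₁_bind₁]
  have hI3 : MvPolynomial.bind₁ abar fbar =
      C (HahnSeries.single Q α) * (1 + C (HahnSeries.single (E : ℤ) (1 : F)) * G) ^ bf +
        MvPolynomial.bind₁ θεL (MvPolynomial.bind₁ θML (MvPolynomial.map ψ ErrK)) := by
    rw [habar3, hI2, map_add, map_mul, bind₁_C_right, map_pow, map_add, map_one, hscale]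
  have hE3 : PolyOrdGE (((E : ℤ) + 1) * (q + 1))
      (MvPolynomial.bind₁ θεL (MvPolynomial.bind₁ θML (MvPolynomial.map ψ ErrK))) :=
    hE2.bind₁ hθεL0
  -- Step 4: `G = g + O(ε^{D+1})`, `G = O(1)`
  have hG0 : PolyOrdGE 0 G := by
    rw [hG, hφL, ← MvPolynomial.map_map]
    simpa using (polyOrdGE_zero_map_polynomial g₂').map_epsPow E
  have hE4 : PolyOrdGE ((E : ℤ) + 1) (G - gbar) := by
    have h1 := (polyOrdGE_one_map_polynomial_sub g₂').map_epsPow E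
    rw [hg₂'g, map_sub, map_epsPow_map_algebraMap, MvPolynomial.map_map, ← hφL, ← hG, ← hgbar,
      mul_one] at h1
    exact h1
  -- Step 5: binomial expansion
  obtain ⟨W, hW⟩ := add_pow_eq_remainder (C (HahnSeries.single (E : ℤ) (1 : F)) * G) bf
  have hW0 : PolyOrdGE 0 ((W.map (Nat.castRingHom _)).eval
      (C (HahnSeries.single (E : ℤ) (1 : F)) * G)) :=
    polyOrdGE_zero_eval_natPoly W (((PolyOrdGE.C (IsOrdGE.single _ _)).mul hG0).mono (by omega))
  -- Step 6: the `f`-oracle circuit computes `g + O(ε)`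
  have hs1 : HahnSeries.single (-(Q + E)) ((α * bf : F)⁻¹) * HahnSeries.single Q α = w := by
    rw [HahnSeries.single_mul_single, hw]
    congr 1
    · ring
    · field_simp
  have hs3 : w * (bf : LaurentSeries F) * HahnSeries.single (E : ℤ) (1 : F) = 1 := by
    rw [hw, ← map_natCast (HahnSeries.C : F →+* LaurentSeries F) bf, HahnSeries.C_apply,
      HahnSeries.single_mul_single, HahnSeries.single_mul_single, ← HahnSeries.single_zero_one]
    congr 1
    · ring
    · field_simp
  have hmain : PolyOrdGE 1
      (C (algebraMap (RatFunc F) (LaurentSeries F) u) * MvPolynomial.bind₁ abar fbar +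
        C (algebraMap (RatFunc F) (LaurentSeries F) v) - gbar) := by
    rw [hubar, hvbar, hI3, hW]
    have key : C (HahnSeries.single (-(Q + E)) ((α * bf : F)⁻¹)) *
        (C (HahnSeries.single Q α) * (1 + (bf : MvPolynomial ι (LaurentSeries F)) *
          (C (HahnSeries.single (E : ℤ) (1 : F)) * G) +
          (C (HahnSeries.single (E : ℤ) (1 : F)) * G) ^ 2 *
            (W.map (Nat.castRingHom _)).eval (C (HahnSeries.single (E : ℤ) (1 : F)) * G)) +
          MvPolynomial.bind₁ θεL (MvPolynomial.bind₁ θML (MvPolynomial.map ψ ErrK))) +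
        C (-w) - gbar =
      (C (HahnSeries.single (-(Q + E)) ((α * bf : F)⁻¹) * HahnSeries.single Q α) - C w) +
      ((C (HahnSeries.single (-(Q + E)) ((α * bf : F)⁻¹) * HahnSeries.single Q α *
          (bf : LaurentSeries F) * HahnSeries.single (E : ℤ) (1 : F)) - 1) * gbar +
        C (HahnSeries.single (-(Q + E)) ((α * bf : F)⁻¹) * HahnSeries.single Q α *
          (bf : LaurentSeries F) * HahnSeries.single (E : ℤ) (1 : F)) * (G - gbar)) +
      C (HahnSeries.single (-(Q + E)) ((α * bf : F)⁻¹) * HahnSeries.single Q α *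
          HahnSeries.single (E : ℤ) (1 : F) ^ 2) *
        (G ^ 2 * (W.map (Nat.castRingHom _)).eval (C (HahnSeries.single (E : ℤ) (1 : F)) * G)) +
      C (HahnSeries.single (-(Q + E)) ((α * bf : F)⁻¹)) *
        MvPolynomial.bind₁ θεL (MvPolynomial.bind₁ θML (MvPolynomial.map ψ ErrK)) := by
      simp only [map_mul, map_neg, map_pow,
        ← map_natCast (C : LaurentSeries F →+* MvPolynomial ι (LaurentSeries F)) bf]
      ring
    rw [key]
    refine ((PolyOrdGE.add ?_ ?_).add ?_).add ?_
    · rw [hs1, sub_self]; exact PolyOrdGE.zero 1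
    · rw [hs1, hs3, C_1, sub_self, zero_mul, zero_add, one_mul]
      exact hE4.mono (by omega)
    · have hord : IsOrdGE (E : ℤ) (HahnSeries.single (-(Q + E)) ((α * bf : F)⁻¹) *
          HahnSeries.single Q α * HahnSeries.single (E : ℤ) (1 : F) ^ 2) := by
        rw [hs1, hw, sq, HahnSeries.single_mul_single, HahnSeries.single_mul_single]
        convert IsOrdGE.single (F := F) _ _ using 2; ring
      have := (PolyOrdGE.C hord).mul ((hG0.pow 2).mul hW0)
      exact this.mono (by simp only [add_zero]; exact_mod_cast hEpos)
    · have hord : IsOrdGE (-(Q + E)) (HahnSeries.single (-(Q + E)) ((α * bf : F)⁻¹)) :=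
        IsOrdGE.single _ _
      have := (PolyOrdGE.C hord).mul hE3
      have heq : -(Q + (E : ℤ)) + ((E : ℤ) + 1) * (q + 1) = 1 := by rw [hQ]; ring
      exact this.mono heq.symm.le
  -- Step 7: replace the `f`-oracle by the `h(·, ε^{N+1})`-oracle
  have hdiff : PolyOrdGE 1 (C (algebraMap (RatFunc F) (LaurentSeries F) u) *
      MvPolynomial.bind₁ abar (MvPolynomial.map (epsPow F N) h - fbar)) := by
    have hsub : MvPolynomial.map (epsPow F N) h - fbar = MvPolynomial.map (epsPow F N) (h - fbar) := by
      rw [map_sub, hfbar, map_epsPow_map_algebraMap]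
    have h1 : PolyOrdGE (((N : ℤ) + 1) * 1) (MvPolynomial.map (epsPow F N) (h - fbar)) :=
      (hfbar ▸ hh).map_epsPow N
    have hdeg : (MvPolynomial.map (epsPow F N) (h - fbar)).totalDegree ≤ Dh := by
      rw [hDh]; exact totalDegree_map_le' _ _
    have h2 := h1.bind₁_of_totalDegree_le hdeg habar_ord
    have hord : IsOrdGE (-(Q + E)) (algebraMap (RatFunc F) (LaurentSeries F) u) := by
      rw [hubar]; exact IsOrdGE.single _ _
    rw [hsub]
    refine ((PolyOrdGE.C hord).mul h2).mono ?_
    have : Q + (E : ℤ) ≤ ((Q + E).toNat : ℤ) := Int.self_le_toNat _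
    rw [hN]; push_cast; nlinarith
  -- conclusion
  have hfin := hmain.add hdiff
  have hfun : (fun x => MvPolynomial.map (algebraMap (RatFunc F) (LaurentSeries F)) (a x)) = abar :=
    funext haL
  rw [MvPolynomial.aeval_eq_bind₁, hfun, ← hgbar]
  have heq : C (algebraMap (RatFunc F) (LaurentSeries F) u) *
        MvPolynomial.bind₁ abar (MvPolynomial.map (epsPow F N) h) +
      C (algebraMap (RatFunc F) (LaurentSeries F) v) - gbar =
      C (algebraMap (RatFunc F) (LaurentSeries F) u) * MvPolynomial.bind₁ abar fbar +
        C (algebraMap (RatFunc F) (LaurentSeries F) v) - gbar +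
      C (algebraMap (RatFunc F) (LaurentSeries F) u) *
        MvPolynomial.bind₁ abar (MvPolynomial.map (epsPow F N) h - fbar) := by
    rw [map_sub]; ring
  rw [heq]
  exact hfin


/-- The char-`p` bullet of Thm. 4.4 as typed (`AndrewsForbes2022_thm_4_4_posChar`), from Prop. 4.2's
conclusion over every field of positive characteristic. [cite: AndrewsForbes2022, Thm. 4.4 (second bullet)] -/
theorem AndrewsForbes2022_thm_4_4_posChar_of
    (h42all : ∀ (p : ℕ) [Fact p.Prime] (F : Type) [Field F] [CharP F p] (n r : ℕ), 0 < r → r ≤ n →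
      ∀ f : MvPolynomial (SkewVarIdx (2 * n)) F, f ∈ pfaffIdeal F n r → f ≠ 0 →
      ∃ (P : Matrix (Fin (2 * n)) (Fin (2 * n)) (RatFunc F)) (q : ℤ) (α : F) (σ : Multiset ℕ),
        IsUnit P ∧ α ≠ 0 ∧ 2 * r ≤ σ.sup ∧ (∀ s ∈ σ, Even s ∧ 0 < s ∧ s ≤ 2 * n) ∧
        ∀ e : SkewVarIdx (2 * n) →₀ ℕ,
          IsBigOEps F (q + 1) (MvPolynomial.coeff e
            (skewCongr P f -
              MvPolynomial.C (RatFunc.X ^ q * algebraMap F (RatFunc F) α) *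
                MvPolynomial.map (algebraMap F (RatFunc F)) (kPfaffMonomial F (2 * n) σ)))) :
    AndrewsForbes2022_thm_4_4_posChar :=
  fun p _ F _ _ n r f hf hf0 h hh ι g hg =>
    AndrewsForbes2022_thm_4_4_posChar_at p F (fun n r => h42all p F n r) n r f hf hf0 h hh ι g hg

end Literature.Computability.AlgebraicComplexity
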